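import Literature.Computability.FineGrained.KSatExponentGap
import Literature.Computability.FineGrained.SATBruteForceMachine
import Literature.Computability.FineGrained.LightSatMachine
import Literature.Computability.FineGrained.IPLemma2Assembly
import Literature.Computability.FineGrained.CompactionMachine
import HarnessLib

/-!
# `s_k ≤ (1 - d/k) s_∞`: Impagliazzo–Paturi's Theorem 3 reduced to two machine facts

Sibling proof file of `KSatExponentGap.lean` (D-0014). There, Theorem 3 of Impagliazzo–Paturi
(JCSS 62 (2001), p. 374; the named fact `Literature.Computability.FineGrained.satExponent_le_satExponentLimit` of
`FineGrainedWave0.lean`) is assembled from three named facts,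
`satExponent_le_satExponentLimit_of h₁ h₂ h₃`. Two of them are theorems of the tree:

* `h₁ : kSATInExpTime_one` — `kSATInExpTime_one_holds` (`SATBruteForceMachine.lean`: brute-force
  k-SAT on `Turing.FinTM2` in time `2^n · poly(L)`);
* `h₂ : lightKSAT_exhaustiveSearch` — `lightKSAT_exhaustiveSearch_holds` (`LightSatMachine.lean`:
  the budgeted splitting search of the assignments with at most `⌊n/N⌋` ones, in time
  `2^{h(1/N) n} · poly(L)` by van Lint's entropy estimate).

Hence Theorem 3 holds as soon as Lemma 2 of the paper (the named fact
`impagliazzoPaturi_lemma2`) does: `satExponent_le_satExponentLimit_of_lemma2`. Lemma 2 in turn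
is assembled in `IPLemma2Assembly.lean` (`IPLemma2.impagliazzoPaturi_lemma2_of`) from three
machine facts, of which the compaction `kCNF_compact_computable` is a theorem
(`Compaction.kCNF_compact_computable_holds`, `CompactionMachine.lean`); so Lemma 2 and
Theorem 3 follow from the two remaining machine facts — the sparsification algorithm
(`sparsification`, fine-grained.S05, Impagliazzo–Paturi–Zane) and the renaming machine
(`ipRename_reduceList_computable`): `impagliazzoPaturi_lemma2_of_machines`,
`satExponent_le_satExponentLimit_of_two_machines`.

## References

* R. Impagliazzo, R. Paturi, *On the complexity of k-SAT*, JCSS 62 (2001), Lemma 2 (p. 373),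
  Theorem 3 (p. 374).
* R. Impagliazzo, R. Paturi, F. Zane, *Which problems have strongly exponential complexity?*,
  JCSS 63 (2001), Corollary 1.
-/

namespace Literature.Computability.FineGrained

/-- **Impagliazzo–Paturi 2001, Theorem 3, from their Lemma 2 alone**: the named fact
`satExponent_le_satExponentLimit` (`s_k ≤ (1 - d/k) s_∞` for an absolute `d > 0` and all
`k ≥ 3`) follows from `impagliazzoPaturi_lemma2`, the exhaustive-search ingredients of the
printed proof being theorems (`kSATInExpTime_one_holds`, `lightKSAT_exhaustiveSearch_holds`).
[cite: ImpagliazzoPaturiJCSS2001, Theorem 3 (p. 374)] -/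
theorem satExponent_le_satExponentLimit_of_lemma2 (h : impagliazzoPaturi_lemma2) :
    satExponent_le_satExponentLimit :=
  satExponent_le_satExponentLimit_of kSATInExpTime_one_holds lightKSAT_exhaustiveSearch_holds h

/-- **Impagliazzo–Paturi 2001, Lemma 2, from the two remaining machine facts**: the
sparsification algorithm (`sparsification`) and the renaming machine
(`ipRename_reduceList_computable`), the compaction being the theorem
`Compaction.kCNF_compact_computable_holds`.
[cite: ImpagliazzoPaturiJCSS2001, Lemma 2 (p. 373)] -/
theorem impagliazzoPaturi_lemma2_of_machines (h₃ : sparsification)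
    (h₄ : ipRename_reduceList_computable) : impagliazzoPaturi_lemma2 :=
  IPLemma2.impagliazzoPaturi_lemma2_of Compaction.kCNF_compact_computable_holds h₃ h₄

/-- **Impagliazzo–Paturi 2001, Theorem 3, from the two remaining machine facts.**
[cite: ImpagliazzoPaturiJCSS2001, Theorem 3 (p. 374)] -/
theorem satExponent_le_satExponentLimit_of_two_machines (h₃ : sparsification)
    (h₄ : ipRename_reduceList_computable) : satExponent_le_satExponentLimit :=
  satExponent_le_satExponentLimit_of_lemma2 (impagliazzoPaturi_lemma2_of_machines h₃ h₄)

end Literature.Computability.FineGrained
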